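import Literature.Probability.LatticeModels.KCSectionFamilyBoundaryHb
import Literature.Probability.LatticeModels.PlanarIsingDiscApprox
import HarnessLib

/-!
# Frozen sites near the boundary of an approximable domain

Topic `Literature/Probability/LatticeModels`. A lemma of discrete geometry used by the Dirichlet
boundary analysis of the Kadanoff–Ceva primitive (Chelkak–Hongler–Izyurov 2015, §3.4 (3.20): the
boundary condition is felt within `O(d)` of every collar cell): under CHI's standing approximation
hypothesis `MeshApproximates Ω` (`PlanarIsingOnePoint.lean`: the mesh polygons of the free sites
converge to `Ω` in the Hausdorff sense), **every boundary point of `Ω` is, for all small `δ`, within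
any prescribed `η > 0` of the mesh point of a site that is not free**
(`eventually_exists_not_mem_near_frontier`). Ingredients: a point of the frontier of the mesh polygon
of a set of sites `Λ` is within `2δ` of the mesh point of a site outside `Λ`
(`exists_not_mem_near_of_mem_frontier_meshPolygon`: the cells tile the plane,
`mem_meshCell_nearestSite`), and `infDist ≤ hausdorffDist`.

Everything is proved; no named fact.

## References

* D. Chelkak, C. Hongler, K. Izyurov, Ann. of Math. 181 (2015), §2.1 (approximations) and §3.4
  [ChelkakHonglerIzyurovAnnals2015].
-/

noncomputable section

namespace Literature.Probability.LatticeModels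

open Complex Filter Metric Set _root_.Topology

/-- A point of a closed cell is within `δ` of its centre (for `δ ≥ 0`). [folklore] -/
theorem dist_meshPoint_le_of_mem_meshCell (δ : ℝ) {x : Site 2} {z : ℂ} (hz : z ∈ meshCell δ x) :
    dist (meshPoint δ x) z ≤ δ := by
  obtain ⟨h0, h1⟩ := hz
  have := dist_meshPoint_le_abs_add_abs δ x z
  rw [abs_sub_comm (δ * (x 0 : ℝ)), abs_sub_comm (δ * (x 1 : ℝ))] at this
  linarith

/-- **A frontier point of a mesh polygon is within `2δ` of a site outside the set.** [folklore] -/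
theorem exists_not_mem_near_of_mem_frontier_meshPolygon {δ : ℝ} (hδ : 0 < δ) {Λ : Set (Site 2)} {z : ℂ}
    (hz : z ∈ frontier (meshPolygon Λ δ)) : ∃ p ∉ Λ, dist (meshPoint δ p) z ≤ 2 * δ := by
  -- `z ∈ closure (⋃ cells)ᶜ`
  have h1 : z ∈ closure (meshPolygon Λ δ)ᶜ := (frontier_eq_closure_inter_closure (s := meshPolygon Λ δ) ▸ hz).2
  have h2 : (meshPolygon Λ δ)ᶜ = closure (⋃ x ∈ Λ, meshCell δ x)ᶜ := by
    rw [meshPolygon, ← closure_compl]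
  rw [h2, closure_closure] at h1
  obtain ⟨z', hz', hzz'⟩ := Metric.mem_closure_iff.1 h1 (δ / 2) (by positivity)
  refine ⟨nearestSite δ z', fun hp => hz' (mem_iUnion₂.2 ⟨_, hp, mem_meshCell_nearestSite hδ z'⟩), ?_⟩
  calc dist (meshPoint δ (nearestSite δ z')) z ≤ dist (meshPoint δ (nearestSite δ z')) z' + dist z' z := dist_triangle _ _ _
    _ ≤ δ + δ / 2 := by
        refine add_le_add (dist_meshPoint_le_of_mem_meshCell δ (mem_meshCell_nearestSite hδ z')) ?_
        rw [dist_comm]; exact hzz'.le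
    _ ≤ 2 * δ := by linarith

/-- Mesh points of free sites are points of `Ω` (for bounded `Ω`, `δ > 0`). [folklore] -/
theorem meshPoint_mem_of_mem_meshInteriorFinset {Ω : Set ℂ} (hΩb : Bornology.IsBounded Ω) {δ : ℝ} (hδ : 0 < δ)
    {x : Site 2} (hx : x ∈ meshInteriorFinset Ω δ) : meshPoint δ x ∈ Ω := by
  have := Finset.mem_coe.2 (meshInteriorFinset_subset_meshDomainFinset Ω δ hx)
  rw [coe_meshDomainFinset hΩb hδ] at this
  exact meshDomain_subset_meshVertices _ _ this

/-- The mesh polygon of the free sites of a bounded set is bounded. [folklore] -/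
theorem isBounded_meshInteriorPolygon {Ω : Set ℂ} (hΩb : Bornology.IsBounded Ω) {δ : ℝ} (hδ : 0 < δ) :
    Bornology.IsBounded (meshInteriorPolygon Ω δ) := by
  obtain ⟨R, hR⟩ := hΩb.subset_closedBall 0
  refine (Metric.isBounded_closedBall (x := (0 : ℂ)) (r := R + δ)).subset ?_
  intro z hz
  have hz' : z ∈ ⋃ x ∈ (↑(meshInteriorFinset Ω δ) : Set (Site 2)), meshCell δ x := interior_subset hz
  obtain ⟨x, hx, hzx⟩ := mem_iUnion₂.1 hz'
  have hxΩ : meshPoint δ x ∈ Ω := meshPoint_mem_of_mem_meshInteriorFinset hΩb hδ hx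
  have h1 := hR hxΩ
  rw [mem_closedBall] at h1 ⊢
  have h2 := dist_meshPoint_le_of_mem_meshCell δ hzx
  have := dist_triangle z (meshPoint δ x) 0
  rw [dist_comm z (meshPoint δ x)] at this
  linarith

/-- In `ℂ`, a nonempty bounded set has nonempty frontier. [folklore] -/
theorem frontier_nonempty_of_isBounded {s : Set ℂ} (hs : s.Nonempty) (hb : Bornology.IsBounded s) : (frontier s).Nonempty := by
  by_contra h
  rw [not_nonempty_iff_eq_empty, ← isClopen_iff_frontier_eq_empty, isClopen_iff] at h
  rcases h with h | h
  · exact hs.ne_empty h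
  · rw [h] at hb
    exact NormedSpace.unbounded_univ ℝ ℂ hb

/-- **Under `MeshApproximates`, every boundary point of `Ω` is eventually within `η` of a non-free
site.** [cite: ChelkakHonglerIzyurovAnnals2015, §2.1 (Hausdorff approximation of ∂Ω by ∂Ω_δ)] -/
theorem eventually_exists_not_mem_near_frontier {Ω : Set ℂ} (hΩb : Bornology.IsBounded Ω) (hΩne : Ω.Nonempty)
    (hM : MeshApproximates Ω) {η : ℝ} (hη : 0 < η) :
    ∀ᶠ δ in 𝓝[>] (0 : ℝ), ∀ w ∈ frontier Ω, ∃ p ∉ meshInteriorFinset Ω δ, dist (meshPoint δ p) w ≤ η := by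
  obtain ⟨a, ha⟩ := hΩne
  -- the polygon eventually contains `a`, and is bounded
  have hK := hM.2.2 {a} isCompact_singleton (singleton_subset_iff.2 ha)
  have hH : ∀ᶠ δ in 𝓝[>] (0 : ℝ), hausdorffDist (frontier (meshInteriorPolygon Ω δ)) (frontier Ω) < η / 2 :=
    hM.2.1 (Iio_mem_nhds (by positivity))
  have hδη : ∀ᶠ δ in 𝓝[>] (0 : ℝ), δ < η / 4 := mem_nhdsWithin_of_mem_nhds (Iio_mem_nhds (by positivity))
  filter_upwards [hK, hH, hδη, self_mem_nhdsWithin] with δ hK hH hδη hδ0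
  have hδ0 : (0 : ℝ) < δ := hδ0
  intro w hw
  have hPb := isBounded_meshInteriorPolygon hΩb hδ0
  have hPne : (meshInteriorPolygon Ω δ).Nonempty := ⟨a, hK (mem_singleton a)⟩
  have hfP : (frontier (meshInteriorPolygon Ω δ)).Nonempty := frontier_nonempty_of_isBounded hPne hPb
  have hfΩ : (frontier Ω).Nonempty := ⟨w, hw⟩
  have hfin : Metric.hausdorffEDist (frontier Ω) (frontier (meshInteriorPolygon Ω δ)) ≠ ⊤ :=
    Metric.hausdorffEDist_ne_top_of_nonempty_of_bounded hfΩ hfP (hΩb.closure.subset frontier_subset_closure)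
      (hPb.closure.subset frontier_subset_closure)
  have h1 : infDist w (frontier (meshInteriorPolygon Ω δ)) < η / 2 := by
    refine lt_of_le_of_lt (infDist_le_hausdorffDist_of_mem hw hfin) ?_
    rwa [hausdorffDist_comm]
  obtain ⟨z, hz, hwz⟩ := (infDist_lt_iff hfP).1 h1
  obtain ⟨p, hp, hpz⟩ := exists_not_mem_near_of_mem_frontier_meshPolygon hδ0 hz
  refine ⟨p, fun hp' => hp (Finset.mem_coe.2 hp'), ?_⟩
  calc dist (meshPoint δ p) w ≤ dist (meshPoint δ p) z + dist z w := dist_triangle _ _ _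
    _ ≤ 2 * δ + η / 2 := add_le_add hpz (by rw [dist_comm]; exact hwz.le)
    _ ≤ η := by linarith

end Literature.Probability.LatticeModels
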